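import Summits.Parity.BatemanHorn.Theorems.SelbergDelangeRigidityDefs
import Summits.Parity.BatemanHorn.Theorems.SelbergDelangeRigidityLSDRealSegmentEulerFactorAux
import Literature.NumberTheory.Sieve.PolynomialCongruencesLemmas
import Literature.NumberTheory.LFunctions.PolynomialRootMertensFirst
import HarnessLib

/-!
# Route `SelbergDelangeRigidity`, crux `LSDRealSegment` (stmt-Parity-9770), line
# `product-anatomy-subcritical`: local structure of the Type-I coefficient `b(m) = g_y(m) ρ_F(m)/m`
# (helper of `stub_typeI`)

For a Bateman–Horn system `f = (f₁, …, f_k)`, real `1 ≤ y < 2`, `g_y = omegaWeight y` (`g_y(p^a) = (y − 1) y^{a−1}`,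
`y^{Ω(m)} = Σ_{d ∣ m} g_y(d)`) and `ρ_F(m) = polyRootCountMod f m`, the Type-I coefficient `b(m) = g_y(m) ρ_F(m) / m`
satisfies the hypotheses of the Levin–Faĭnleĭb mean-value theorem with `κ = k(y − 1)`:
* `b ≥ 0`, `b(1) = 1`, `b` multiplicative on coprime arguments (CRT for `ρ_F`: `polyRootCountMod_mul_of_coprime`);
* `b(p^ν) = (y−1) y^{ν−1} ρ_F(p^ν)/p^ν ≤ C (y/p)^ν` (UNIFORM Nagell bound `exists_polyRootCountMod_prime_pow_le_of_system`),
  so `Σ_ν b(p^ν)` converges for EVERY prime `p` exactly because `y < 2 ≤ p`, with sum `E_p(y) = localFactor f p y`;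
* (H1) `|Σ_{p ≤ Q} b(p) log p − κ log Q| ≤ L`: `ρ_F(p) = Σᵢ ρ_{fᵢ}(p)` for `p > P₀` (`exists_polyRootCountMod_eq_sum`)
  and Landau–Mertens for the roots of each `fᵢ` (`DegreeOnePrimes.abs_sum_primesLE_rootCount_mul_log_div_sub_log_le`);
* (H2) `Σ_p b(p)² log p + Σ_p Σ_{ν ≥ 2} b(p^ν) log p^ν ≤ A`: both pieces are `≪ Σ_p log p / p²`
  (`Σ_{ν ≥ 2} ν (y/p)^ν ≤ (y/p)² Σ_j (j+2)(y/2)^j`, convergent as `y < 2`).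
-/

open Filter Finset Polynomial
open scoped BigOperators Topology Classical

namespace Summit.Parity.BatemanHorn.Cruxes.LSDRealSegment.ProductAnatomySubcritical

open Literature.NumberTheory.Sieve
open ArithmeticFunction (cardFactors)
noncomputable section

variable {k : ℕ}

/-! ### The weight `g_y` for real `y ≥ 1` -/

/-- `g_y(p^a) ≥ 0` for `y ≥ 1`. [folklore] -/
theorem omegaCoeff_nonneg {y : ℝ} (hy : 1 ≤ y) (a : ℕ) : 0 ≤ omegaCoeff y a := by
  cases a with
  | zero => simp
  | succ a => exact mul_nonneg (by linarith) (pow_nonneg (by linarith) _)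

/-- `g_y(p^a) ≤ y^a` for `y ≥ 1`. [folklore] -/
theorem omegaCoeff_le_pow {y : ℝ} (hy : 1 ≤ y) (a : ℕ) : omegaCoeff y a ≤ y ^ a := by
  cases a with
  | zero => simp
  | succ a => rw [omegaCoeff_succ, pow_succ']; gcongr; linarith

/-- `g_y(d) ≥ 0` for `y ≥ 1`. [folklore] -/
theorem omegaWeight_nonneg {y : ℝ} (hy : 1 ≤ y) (d : ℕ) : 0 ≤ omegaWeight y d := by
  unfold omegaWeight Finsupp.prod
  exact Finset.prod_nonneg fun p _ => omegaCoeff_nonneg hy _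

/-- `g_y(1) = 1`. [folklore] -/
theorem omegaWeight_one (y : ℝ) : omegaWeight y 1 = 1 := by
  simp [omegaWeight]

/-! ### The root count `ρ_F` of the product -/

/-- `ρ_F(1) = 1`. [folklore] -/
theorem polyRootCountMod_one (f : Fin k → ℤ[X]) : polyRootCountMod f 1 = 1 := by
  unfold polyRootCountMod
  rw [Finset.filter_true_of_mem fun n _ => by simp, Finset.card_range]

/-- `ρ_F` is multiplicative on coprime moduli (CRT, `polyRootCountMod_mul_of_coprime` for `F = ∏ fᵢ`).
[folklore] -/
theorem polyRootCountMod_mul_of_coprime_system (f : Fin k → ℤ[X]) {m n : ℕ} (h : m.Coprime n) :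
    polyRootCountMod f (m * n) = polyRootCountMod f m * polyRootCountMod f n := by
  simp only [polyRootCountMod_eq_single_prod f]
  exact polyRootCountMod_mul_of_coprime (∏ i, f i) h

/-! ### The coefficient `b(m) = g_y(m) ρ_F(m) / m` -/

/-- `b ≥ 0` for `y ≥ 1`. [folklore] -/
theorem bOmega_nonneg (f : Fin k → ℤ[X]) {y : ℝ} (hy : 1 ≤ y) (m : ℕ) :
    0 ≤ omegaWeight y m * (polyRootCountMod f m : ℝ) / m :=
  div_nonneg (mul_nonneg (omegaWeight_nonneg hy m) (Nat.cast_nonneg _)) (Nat.cast_nonneg _)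

/-- `b(1) = 1`. [folklore] -/
theorem bOmega_one (f : Fin k → ℤ[X]) (y : ℝ) :
    omegaWeight y 1 * (polyRootCountMod f 1 : ℝ) / ((1 : ℕ) : ℝ) = 1 := by
  rw [omegaWeight_one, polyRootCountMod_one]
  simp

/-- `b` is multiplicative on coprime arguments. [folklore] -/
theorem bOmega_mul_of_coprime (f : Fin k → ℤ[X]) (y : ℝ) {m n : ℕ} (h : m.Coprime n) :
    omegaWeight y (m * n) * (polyRootCountMod f (m * n) : ℝ) / ((m * n : ℕ) : ℝ) =
      (omegaWeight y m * (polyRootCountMod f m : ℝ) / m) *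
        (omegaWeight y n * (polyRootCountMod f n : ℝ) / n) := by
  rcases eq_or_ne m 0 with rfl | hm
  · obtain rfl : n = 1 := by simpa using h
    simp
  rcases eq_or_ne n 0 with rfl | hn
  · obtain rfl : m = 1 := by simpa using h
    simp
  rw [omegaWeight_mul y hm hn h, polyRootCountMod_mul_of_coprime_system f h, Nat.cast_mul, Nat.cast_mul]
  have hm' : (m : ℝ) ≠ 0 := by exact_mod_cast hm
  have hn' : (n : ℝ) ≠ 0 := by exact_mod_cast hn
  field_simp

/-- `b` at a prime power: `b(p^ν) = g_y(p^ν) ρ_F(p^ν) / p^ν` with `g_y(p^ν) = omegaCoeff y ν`. [folklore] -/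
theorem bOmega_prime_pow (f : Fin k → ℤ[X]) (y : ℝ) {p : ℕ} (hp : p.Prime) (ν : ℕ) :
    omegaWeight y (p ^ ν) * (polyRootCountMod f (p ^ ν) : ℝ) / ((p ^ ν : ℕ) : ℝ) =
      omegaCoeff y ν * (polyRootCountMod f (p ^ ν) : ℝ) / (p : ℝ) ^ ν := by
  rw [omegaWeight_prime_pow y hp, Nat.cast_pow]

/-- The uniform bound `b(p^ν) ≤ C (y/p)^ν` from `ρ_F(p^a) ≤ C` and `g_y(p^ν) ≤ y^ν`. [folklore] -/
theorem bOmega_prime_pow_le (f : Fin k → ℤ[X]) {y : ℝ} (hy : 1 ≤ y) {p : ℕ} (hp : p.Prime) {C : ℕ}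
    (hC : ∀ a, polyRootCountMod f (p ^ a) ≤ C) (ν : ℕ) :
    omegaWeight y (p ^ ν) * (polyRootCountMod f (p ^ ν) : ℝ) / ((p ^ ν : ℕ) : ℝ) ≤
      C * (y / p) ^ ν := by
  rw [bOmega_prime_pow f y hp, div_pow]
  have hp0 : (0 : ℝ) < (p : ℝ) ^ ν := pow_pos (by exact_mod_cast hp.pos) ν
  rw [div_le_iff₀ hp0, mul_div_assoc', div_mul_cancel₀ _ hp0.ne']
  calc omegaCoeff y ν * (polyRootCountMod f (p ^ ν) : ℝ) ≤ y ^ ν * C :=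
        mul_le_mul (omegaCoeff_le_pow hy ν) (by exact_mod_cast hC ν) (Nat.cast_nonneg _)
          (pow_nonneg (by linarith) _)
    _ = C * y ^ ν := mul_comm _ _

/-! ### The local factor: `Σ_ν b(p^ν) = E_p(y)` -/

/-- For `1 ≤ y < 2 ≤ p` and bounded `ρ_F(p^a)`: the series `Σ_ν b(p^ν)` converges and its sum, cast to `ℂ`,
is the line's local factor `localFactor f p y = 1 + (y − 1) Σ_a ρ_F(p^{a+1}) p^{−a−1} y^a`. [folklore] -/
theorem bOmega_tsum_eq_localFactor (f : Fin k → ℤ[X]) {y : ℝ} (hy : 1 ≤ y) (hy2 : y < 2) {p : ℕ}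
    (hp : p.Prime) {C : ℕ} (hC : ∀ a, polyRootCountMod f (p ^ a) ≤ C) {g : ℕ → ℝ}
    (hg : ∀ m, g m = omegaWeight y m * (polyRootCountMod f m : ℝ) / m) :
    Summable (fun ν : ℕ => g (p ^ ν)) ∧ (((∑' ν : ℕ, g (p ^ ν) : ℝ) : ℂ) = localFactor f p (y : ℂ)) := by
  have hp2 : (2 : ℝ) ≤ p := by exact_mod_cast hp.two_le
  have hp0 : (0 : ℝ) < p := by linarith
  -- the real coefficient series `c a = ρ_F(p^{a+1}) p^{-a-1} y^a`
  set c : ℕ → ℝ := fun a => (polyRootCountMod f (p ^ (a + 1)) : ℝ) / (p : ℝ) ^ (a + 1) * y ^ a with hc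
  have hq0 : 0 ≤ y / p := by positivity
  have hq1 : y / p < 1 := by rw [div_lt_one hp0]; linarith
  have hc0 : ∀ a, 0 ≤ c a := fun a => by positivity
  have hcle : ∀ a, c a ≤ C / p * (y / p) ^ a := by
    intro a
    have hCa : (polyRootCountMod f (p ^ (a + 1)) : ℝ) ≤ C := by exact_mod_cast hC (a + 1)
    simp only [hc]
    rw [div_pow, pow_succ]
    have hpa : (0 : ℝ) < (p : ℝ) ^ a := pow_pos hp0 a
    rw [div_mul_eq_mul_div, div_le_iff₀ (by positivity)]
    calc (polyRootCountMod f (p ^ (a + 1)) : ℝ) * y ^ a ≤ C * y ^ a := by gcongr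
      _ = C / p * (y ^ a / (p : ℝ) ^ a) * ((p : ℝ) ^ a * p) := by field_simp
  have hcs : Summable c :=
    Summable.of_nonneg_of_le hc0 hcle ((summable_geometric_of_lt_one hq0 hq1).mul_left _)
  -- `b(p^{a+1}) = (y - 1) c a`, `b(p^0) = 1`
  have hb1 : ∀ a, g (p ^ (a + 1)) = (y - 1) * c a := by
    intro a
    rw [hg, bOmega_prime_pow f y hp, omegaCoeff_succ]
    simp only [hc]
    ring
  have hb0 : g (p ^ 0) = 1 := by rw [pow_zero, hg]; exact bOmega_one f y
  have hbs1 : Summable (fun a => g (p ^ (a + 1))) := by simp_rw [hb1]; exact hcs.mul_left _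
  have hbs : Summable (fun ν => g (p ^ ν)) := (summable_nat_add_iff 1).mp hbs1
  refine ⟨hbs, ?_⟩
  rw [hbs.tsum_eq_zero_add, hb0]
  simp_rw [hb1]
  rw [tsum_mul_left, Complex.ofReal_add, Complex.ofReal_mul, Complex.ofReal_tsum]
  unfold localFactor
  push_cast
  simp only [hc]
  push_cast
  rfl

/-! ### (H1): the prime mean of `b` is `κ = k(y−1)` -/

/-- **(H1) for `b`**: `|Σ_{p ≤ Q} b(p) log p − k(y−1) log Q| ≤ L` for `Q ≥ 2` (`b(p) = (y−1)ρ_F(p)/p`,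
`ρ_F(p) = Σᵢ ρ_{fᵢ}(p)` for `p > P₀`, Landau–Mertens for the roots of each `fᵢ`). [folklore] -/
theorem bOmega_primeMean {f : Fin k → ℤ[X]} (hf : IsBatemanHornSystem f) {y : ℝ} (hy : 1 ≤ y)
    {g : ℕ → ℝ} (hg : ∀ m, g m = omegaWeight y m * (polyRootCountMod f m : ℝ) / m) :
    ∃ L : ℝ, ∀ Q : ℕ, 2 ≤ Q →
      |(∑ p ∈ Nat.primesLE Q, g p * Real.log p) - (k : ℝ) * (y - 1) * Real.log Q| ≤ L := by
  obtain ⟨P₀, hP₀⟩ := hf.exists_polyRootCountMod_eq_sum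
  have hCi : ∀ i : Fin k, ∃ C : ℝ, ∀ Q : ℕ, 2 ≤ Q →
      |(∑ p ∈ Nat.primesLE Q, (polyRootCountMod ![f i] p : ℝ) * Real.log p / p) - Real.log Q| ≤ C :=
    fun i => Literature.NumberTheory.LFunctions.DegreeOnePrimes.abs_sum_primesLE_rootCount_mul_log_div_sub_log_le
      (f i) (hf.irreducible i) (hf.natDegree_pos i)
  choose Cf hCf using hCi
  -- notation
  set ρ : ℕ → ℝ := fun p => (polyRootCountMod f p : ℝ) with hρ
  set ρi : Fin k → ℕ → ℝ := fun i p => (polyRootCountMod ![f i] p : ℝ) with hρi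
  set δ : ℕ → ℝ := fun p => (ρ p - ∑ i, ρi i p) * Real.log p / p with hδ
  set E : ℝ := ∑ p ∈ Nat.primesLE P₀, |δ p| with hE
  refine ⟨(y - 1) * (E + ∑ i, Cf i), fun Q hQ => ?_⟩
  -- `Σ b(p) log p = (y - 1) S(Q)`
  have hS : ∑ p ∈ Nat.primesLE Q, g p * Real.log p =
      (y - 1) * ∑ p ∈ Nat.primesLE Q, ρ p * Real.log p / p := by
    rw [Finset.mul_sum]
    refine Finset.sum_congr rfl fun p hp => ?_
    have hp' := Nat.prime_of_mem_primesLE hp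
    have h1 : omegaWeight y p = y - 1 := by
      have := omegaWeight_prime_pow y hp' 1
      rw [pow_one] at this
      rw [this, omegaCoeff_succ, pow_zero, mul_one]
    rw [hg, h1, hρ]
    ring
  -- the exceptional primes `p ≤ P₀` move the sum by at most `E`
  have hexc : |(∑ p ∈ Nat.primesLE Q, ρ p * Real.log p / p) -
      ∑ i, ∑ p ∈ Nat.primesLE Q, ρi i p * Real.log p / p| ≤ E := by
    rw [Finset.sum_comm]
    have e1 : (∑ p ∈ Nat.primesLE Q, ρ p * Real.log p / p) -
        ∑ p ∈ Nat.primesLE Q, ∑ i, ρi i p * Real.log p / p = ∑ p ∈ Nat.primesLE Q, δ p := by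
      rw [← Finset.sum_sub_distrib]
      refine Finset.sum_congr rfl fun p _ => ?_
      simp only [hδ]
      rw [← Finset.sum_div, ← Finset.sum_mul]
      ring
    rw [e1, ← Finset.sum_filter_add_sum_filter_not (Nat.primesLE Q) (fun p => p ≤ P₀)]
    have e2 : ∑ p ∈ (Nat.primesLE Q).filter (fun p => ¬ p ≤ P₀), δ p = 0 := by
      refine Finset.sum_eq_zero fun p hp => ?_
      rw [Finset.mem_filter] at hp
      have hp' := Nat.prime_of_mem_primesLE hp.1
      simp only [hδ, hρ, hρi]
      rw [hP₀ p hp' (not_le.mp hp.2)]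
      push_cast
      ring
    rw [e2, add_zero]
    refine (Finset.abs_sum_le_sum_abs _ _).trans ?_
    refine Finset.sum_le_sum_of_subset_of_nonneg (fun p hp => ?_) (fun p _ _ => abs_nonneg _)
    rw [Finset.mem_filter, Nat.mem_primesLE] at hp
    exact Nat.mem_primesLE.mpr ⟨hp.2, hp.1.2⟩
  -- each member contributes `log Q + O(1)`
  have hmem : |(∑ i, ∑ p ∈ Nat.primesLE Q, ρi i p * Real.log p / p) - (k : ℝ) * Real.log Q| ≤
      ∑ i, Cf i := by
    have e1 : (∑ i, ∑ p ∈ Nat.primesLE Q, ρi i p * Real.log p / p) - (k : ℝ) * Real.log Q =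
        ∑ i : Fin k, ((∑ p ∈ Nat.primesLE Q, ρi i p * Real.log p / p) - Real.log Q) := by
      rw [Finset.sum_sub_distrib, Finset.sum_const, Finset.card_univ, Fintype.card_fin, nsmul_eq_mul]
    rw [e1]
    exact (Finset.abs_sum_le_sum_abs _ _).trans (Finset.sum_le_sum fun i _ => hCf i Q hQ)
  have hy0 : 0 ≤ y - 1 := by linarith
  rw [hS, show (k : ℝ) * (y - 1) * Real.log Q = (y - 1) * ((k : ℝ) * Real.log Q) by ring, ← mul_sub,
    abs_mul, abs_of_nonneg hy0]
  refine mul_le_mul_of_nonneg_left ?_ hy0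
  calc |(∑ p ∈ Nat.primesLE Q, ρ p * Real.log p / p) - (k : ℝ) * Real.log Q|
      = |((∑ p ∈ Nat.primesLE Q, ρ p * Real.log p / p) -
            ∑ i, ∑ p ∈ Nat.primesLE Q, ρi i p * Real.log p / p) +
          ((∑ i, ∑ p ∈ Nat.primesLE Q, ρi i p * Real.log p / p) - (k : ℝ) * Real.log Q)| := by
        ring_nf
    _ ≤ _ := abs_add_le _ _
    _ ≤ E + ∑ i, Cf i := add_le_add hexc hmem

/-! ### (H2): prime squares and higher prime powers -/

/-- `Σ_n log n / n² < ∞` (`log n ≤ 2√n`). [folklore] -/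
theorem summable_log_div_sq : Summable (fun n : ℕ => Real.log n / (n : ℝ) ^ 2) := by
  have hs : Summable (fun n : ℕ => 2 * ((n : ℝ) ^ (3 / 2 : ℝ))⁻¹) :=
    (Real.summable_nat_rpow_inv.mpr (by norm_num)).mul_left 2
  refine Summable.of_nonneg_of_le (fun n => div_nonneg (Real.log_natCast_nonneg n) (sq_nonneg _))
    (fun n => ?_) hs
  rcases Nat.eq_zero_or_pos n with rfl | hn
  · simp
  have hn0 : (0 : ℝ) < n := by exact_mod_cast hn
  have h1 : Real.log n ≤ 2 * (n : ℝ) ^ (1 / 2 : ℝ) := by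
    have := Real.log_le_rpow_div (Nat.cast_nonneg n) (by norm_num : (0 : ℝ) < 1 / 2)
    calc Real.log n ≤ (n : ℝ) ^ (1 / 2 : ℝ) / (1 / 2) := this
      _ = 2 * (n : ℝ) ^ (1 / 2 : ℝ) := by ring
  have h2 : (n : ℝ) ^ 2 = (n : ℝ) ^ (1 / 2 : ℝ) * (n : ℝ) ^ (3 / 2 : ℝ) := by
    rw [← Real.rpow_add hn0, ← Real.rpow_two]
    norm_num
  rw [h2, div_le_iff₀ (by positivity)]
  calc Real.log n ≤ 2 * (n : ℝ) ^ (1 / 2 : ℝ) := h1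
    _ = 2 * ((n : ℝ) ^ (3 / 2 : ℝ))⁻¹ * ((n : ℝ) ^ (1 / 2 : ℝ) * (n : ℝ) ^ (3 / 2 : ℝ)) := by
        field_simp

/-- `Σ_{2 ≤ ν ≤ N} ν r^ν ≤ r² Σ_j (j + 2) r₀^j` for `0 ≤ r ≤ r₀ < 1`. [folklore] -/
theorem sum_Icc_mul_pow_le {r r₀ : ℝ} (hr : 0 ≤ r) (hrr : r ≤ r₀) (hr₀ : r₀ < 1) (N : ℕ) :
    ∑ ν ∈ Icc 2 N, (ν : ℝ) * r ^ ν ≤ r ^ 2 * ∑' j : ℕ, ((j : ℝ) + 2) * r₀ ^ j := by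
  have hr0 : 0 ≤ r₀ := hr.trans hrr
  have hsT : Summable (fun j : ℕ => ((j : ℝ) + 2) * r₀ ^ j) := by
    have h1 : Summable (fun j : ℕ => (j : ℝ) ^ 1 * r₀ ^ j) :=
      summable_pow_mul_geometric_of_norm_lt_one 1 (by rw [Real.norm_of_nonneg hr0]; exact hr₀)
    have h2 : Summable (fun j : ℕ => r₀ ^ j) := summable_geometric_of_lt_one hr0 hr₀
    refine (h1.add (h2.mul_left 2)).congr fun j => ?_
    ring
  have e1 : ∑ ν ∈ Icc 2 N, (ν : ℝ) * r ^ ν = ∑ j ∈ range (N + 1 - 2), r ^ 2 * (((j : ℝ) + 2) * r ^ j) := by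
    rw [← Finset.Ico_add_one_right_eq_Icc, Finset.sum_Ico_eq_sum_range]
    refine Finset.sum_congr rfl fun j _ => ?_
    push_cast
    ring
  rw [e1, ← Finset.mul_sum]
  refine mul_le_mul_of_nonneg_left ?_ (sq_nonneg r)
  calc ∑ j ∈ range (N + 1 - 2), ((j : ℝ) + 2) * r ^ j
      ≤ ∑ j ∈ range (N + 1 - 2), ((j : ℝ) + 2) * r₀ ^ j := by gcongr
    _ ≤ ∑' j : ℕ, ((j : ℝ) + 2) * r₀ ^ j := hsT.sum_le_tsum _ fun j _ => by positivity

/-- **(H2) for `b`**: `Σ_{p ≤ N} b(p)² log p + Σ_{p ≤ N} Σ_{2 ≤ ν ≤ N} b(p^ν) log p^ν ≤ A`, from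
`b(p^ν) ≤ C (y/p)^ν`, `y < 2` (so `Σ_{ν ≥ 2} ν (y/p)^ν ≤ (y/p)² T`, `T = Σ_j (j+2)(y/2)^j < ∞` — the `p = 2`
term is where `y < 2` is USED) and `Σ log p / p² < ∞`. [folklore] -/
theorem bOmega_primePowers {f : Fin k → ℤ[X]} (hf : IsBatemanHornSystem f) {y : ℝ} (hy : 1 ≤ y)
    (hy2 : y < 2) {g : ℕ → ℝ} (hg : ∀ m, g m = omegaWeight y m * (polyRootCountMod f m : ℝ) / m) :
    ∃ A : ℝ, ∀ N : ℕ, (∑ p ∈ Nat.primesLE N, g p ^ 2 * Real.log p) +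
      (∑ p ∈ Nat.primesLE N, ∑ ν ∈ Icc 2 N, g (p ^ ν) * Real.log ((p : ℝ) ^ ν)) ≤ A := by
  obtain ⟨C, hC⟩ := exists_polyRootCountMod_prime_pow_le_of_system hf
  set r₀ : ℝ := y / 2 with hr₀
  have hr1 : r₀ < 1 := by rw [hr₀]; linarith
  set T : ℝ := ∑' j : ℕ, ((j : ℝ) + 2) * r₀ ^ j with hT
  have hT0 : 0 ≤ T := tsum_nonneg fun j => by positivity
  set S : ℝ := ∑' n : ℕ, Real.log n / (n : ℝ) ^ 2 with hS
  set K : ℝ := 4 * (C : ℝ) ^ 2 + 4 * C * T with hK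
  refine ⟨K * S, fun N => ?_⟩
  have hy0 : 0 ≤ y := by linarith
  -- `b(p)² log p ≤ 4C² log p / p²`
  have key1 : ∀ p : ℕ, p.Prime → g p ^ 2 * Real.log p ≤ 4 * (C : ℝ) ^ 2 * (Real.log p / (p : ℝ) ^ 2) := by
    intro p hp
    have hp2 : (2 : ℝ) ≤ p := by exact_mod_cast hp.two_le
    have hp0 : (0 : ℝ) < p := by linarith
    have hlog : 0 ≤ Real.log p := Real.log_nonneg (by linarith)
    have hb0 : 0 ≤ g p := by rw [hg]; exact bOmega_nonneg f hy p
    have hb2 : g p ≤ 2 * C / p := by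
      have h := bOmega_prime_pow_le f hy hp (hC p hp) 1
      simp only [pow_one] at h
      rw [hg]
      calc omegaWeight y p * (polyRootCountMod f p : ℝ) / p ≤ C * (y / p) := h
        _ ≤ C * (2 / p) := by gcongr
        _ = 2 * C / p := by ring
    calc g p ^ 2 * Real.log p ≤ (2 * C / p) ^ 2 * Real.log p := by gcongr
      _ = 4 * (C : ℝ) ^ 2 * (Real.log p / (p : ℝ) ^ 2) := by
          field_simp
          ring
  -- `Σ_{2 ≤ ν ≤ N} b(p^ν) log p^ν ≤ 4 C T log p / p²`
  have key2 : ∀ p : ℕ, p.Prime → ∑ ν ∈ Icc 2 N, g (p ^ ν) * Real.log ((p : ℝ) ^ ν) ≤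
      4 * C * T * (Real.log p / (p : ℝ) ^ 2) := by
    intro p hp
    have hp2 : (2 : ℝ) ≤ p := by exact_mod_cast hp.two_le
    have hp0 : (0 : ℝ) < p := by linarith
    have hlog : 0 ≤ Real.log p := Real.log_nonneg (by linarith)
    have hr0' : 0 ≤ y / p := by positivity
    have hrr : y / p ≤ r₀ := by
      rw [hr₀]
      gcongr
    have hterm : ∀ ν ∈ Icc 2 N, g (p ^ ν) * Real.log ((p : ℝ) ^ ν) ≤
        C * Real.log p * ((ν : ℝ) * (y / p) ^ ν) := by
      intro ν _
      rw [Real.log_pow, hg]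
      have h1 := bOmega_prime_pow_le f hy hp (hC p hp) ν
      have h0 : 0 ≤ omegaWeight y (p ^ ν) * (polyRootCountMod f (p ^ ν) : ℝ) / ((p ^ ν : ℕ) : ℝ) :=
        bOmega_nonneg f hy _
      calc omegaWeight y (p ^ ν) * (polyRootCountMod f (p ^ ν) : ℝ) / ((p ^ ν : ℕ) : ℝ) * (ν * Real.log p)
          ≤ C * (y / p) ^ ν * (ν * Real.log p) := by gcongr
        _ = C * Real.log p * ((ν : ℝ) * (y / p) ^ ν) := by ring
    calc ∑ ν ∈ Icc 2 N, g (p ^ ν) * Real.log ((p : ℝ) ^ ν)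
        ≤ ∑ ν ∈ Icc 2 N, C * Real.log p * ((ν : ℝ) * (y / p) ^ ν) := Finset.sum_le_sum hterm
      _ = C * Real.log p * ∑ ν ∈ Icc 2 N, (ν : ℝ) * (y / p) ^ ν := by rw [Finset.mul_sum]
      _ ≤ C * Real.log p * ((y / p) ^ 2 * T) := by
          gcongr
          exact sum_Icc_mul_pow_le hr0' hrr hr1 N
      _ = C * T * y ^ 2 * (Real.log p / (p : ℝ) ^ 2) := by
          rw [div_pow]
          ring
      _ ≤ C * T * 2 ^ 2 * (Real.log p / (p : ℝ) ^ 2) := by gcongr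
      _ = 4 * C * T * (Real.log p / (p : ℝ) ^ 2) := by ring
  -- sum over the primes
  have hlogsum : ∑ p ∈ Nat.primesLE N, Real.log p / (p : ℝ) ^ 2 ≤ S :=
    summable_log_div_sq.sum_le_tsum _ fun n _ => div_nonneg (Real.log_natCast_nonneg n) (sq_nonneg _)
  have hK0 : 0 ≤ K := by positivity
  calc (∑ p ∈ Nat.primesLE N, g p ^ 2 * Real.log p) +
        (∑ p ∈ Nat.primesLE N, ∑ ν ∈ Icc 2 N, g (p ^ ν) * Real.log ((p : ℝ) ^ ν))
      ≤ (∑ p ∈ Nat.primesLE N, 4 * (C : ℝ) ^ 2 * (Real.log p / (p : ℝ) ^ 2)) +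
          ∑ p ∈ Nat.primesLE N, 4 * C * T * (Real.log p / (p : ℝ) ^ 2) :=
        add_le_add (Finset.sum_le_sum fun p hp => key1 p (Nat.prime_of_mem_primesLE hp))
          (Finset.sum_le_sum fun p hp => key2 p (Nat.prime_of_mem_primesLE hp))
    _ = K * ∑ p ∈ Nat.primesLE N, Real.log p / (p : ℝ) ^ 2 := by
        rw [hK, ← Finset.mul_sum, ← Finset.mul_sum]
        ring
    _ ≤ K * S := by gcongr

/-! ### The registered helper -/

/-- **typeI_local** (registered helper of `stub_typeI`, line `product-anatomy-subcritical`): for a Bateman–Horn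
system `f`, real `1 ≤ y < 2` and the Type-I coefficient `b(m) = g_y(m) ρ_F(m)/m` (`g_y = omegaWeight y`,
`ρ_F = polyRootCountMod f`): `b ≥ 0`, `b(1) = 1`, `b` multiplicative on coprime arguments, the prime mean
(H1) `|Σ_{p ≤ Q} b(p) log p − k(y−1) log Q| ≤ L`, the prime-power bound (H2)
`Σ_p b(p)² log p + Σ_p Σ_{ν≥2} b(p^ν) log p^ν ≤ A`, and at every prime `Σ_ν b(p^ν) = E_p(y) = localFactor f p y`
(convergent because `y < 2 ≤ p`). [folklore] -/
theorem typeI_local : ∀ (k : ℕ) (f : Fin k → ℤ[X]), IsBatemanHornSystem f → ∀ y : ℝ, 1 ≤ y → y < 2 →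
    ∀ g : ℕ → ℝ, (∀ m, g m = omegaWeight y m * (polyRootCountMod f m : ℝ) / m) →
      (∀ m, 0 ≤ g m) ∧ g 1 = 1 ∧ (∀ m n : ℕ, m.Coprime n → g (m * n) = g m * g n) ∧
      (∃ L : ℝ, ∀ Q : ℕ, 2 ≤ Q →
        |(∑ p ∈ Nat.primesLE Q, g p * Real.log p) - (k : ℝ) * (y - 1) * Real.log Q| ≤ L) ∧
      (∃ A : ℝ, ∀ N : ℕ, (∑ p ∈ Nat.primesLE N, g p ^ 2 * Real.log p) +
        (∑ p ∈ Nat.primesLE N, ∑ ν ∈ Icc 2 N, g (p ^ ν) * Real.log ((p : ℝ) ^ ν)) ≤ A) ∧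
      (∀ p : ℕ, p.Prime → Summable (fun ν : ℕ => g (p ^ ν)) ∧
        (((∑' ν : ℕ, g (p ^ ν) : ℝ) : ℂ) = localFactor f p (y : ℂ))) := by
  intro k f hf y hy hy2 g hg
  refine ⟨fun m => ?_, ?_, fun m n hmn => ?_, bOmega_primeMean hf hy hg, bOmega_primePowers hf hy hy2 hg,
    fun p hp => ?_⟩
  · rw [hg]
    exact bOmega_nonneg f hy m
  · rw [hg]
    exact bOmega_one f y
  · rw [hg, hg m, hg n]
    exact bOmega_mul_of_coprime f y hmn
  · obtain ⟨C, hC⟩ := exists_polyRootCountMod_prime_pow_le_of_system hf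
    exact bOmega_tsum_eq_localFactor f hy hy2 hp (hC p hp) hg

end

end Summit.Parity.BatemanHorn.Cruxes.LSDRealSegment.ProductAnatomySubcritical
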